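import Summits.FinalStateConjecture.FinalStateConjecture.Theorems.ClusterCompletenessAdiabaticMultiKerrILEDSplit
import Summits.FinalStateConjecture.FinalStateConjecture.Theorems.ClusterCompletenessAdiabaticMultiKerrILEDZeroSpinFarEnergyBound
import Summits.FinalStateConjecture.FinalStateConjecture.Theses.ClusterCompleteness

/-!
# Crux `AdiabaticMultiKerrILED` — line `rest-frame-seams` (strategist s3, 2026-08-17)

Alternative registered line for crux item `stmt-FinalStateConjecture-14310`
(`Summit.FinalStateConjecture.FinalStateConjecture.Theses.ClusterCompleteness.AdiabaticMultiKerrILED`).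
It does NOT replace the live line `Sketch` (lead c7, skeleton v9, stubs FB = `stub_farEnergyBound_pos`,
NZ = `stub_nearZoneILED_pos`) nor the strategist-s2 line `zone-seams` (FB/NZ cut as N = 1 | N ≥ 2); it re-cuts the
same certified reduction `crux ⇐ FB₁ ∧ NZ₁ ∧ FB₂ ∧ NZ₂` (route-level split glue LANDED, p154333:
`…Theorems.ClusterCompleteness.AdiabaticMultiKerrILEDSplit.adiabaticMultiKerrILED_of_subs`) one level further on the
SINGLE-ZONE side, along the frame seam that lead c7's zero-spin closure exposed:

* `stub_restFrameFarEnergyBound_smallSpin` (RFB, research) — uniform boundedness away from a collar for ONE tails-cut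
  slowly rotating zone `g_χ(a)`, `|a| ≤ αM`, in ITS REST FRAME, data and fluxes on TILTED leaves `{x⁰ = s + F(x⃗)}`,
  `‖∇F‖ ≤ 1/2`: the literal `a ≠ 0` extension of the LANDED zero-spin theorem `restFrame_farEnergyBound` (p162234),
  which is re-derived below as the sorry-free rung `restFrameFarEnergyBound_zeroSpin_rung` (BC5-style witness: the
  stub's `a = 0` instance is in the tree);
* `stub_restFrameZoneILED_smallSpin` (RILED, research) — integrated local energy decay with loss of one derivative
  (loss vector `k`, any constant future-timelike vector of coordinate speed `≤ 1/2`, `k⁰ ≥ 1`), first + zeroth order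
  on `{r₊ < r < 64M}`, same rest-frame tilted-leaf format (zero-spin instance = the Morawetz `X`-estimate for
  `g_χ(0)` designed in crux NOTES §7c);
* `stub_farEnergyBound_single_of_rest` (T1, classical) and `stub_nearZoneILED_single_of_rest` (T2, classical) —
  the Poincaré/lab TRANSPORT of RFB / RILED to the route's lab-frame children `SingleZoneFarEnergyBound` /
  `SingleZoneNearILED` (pattern: `singleZoneFarEnergyBound_zeroSpin_of_rest`, p161639; pull-back
  `tailsCut_pullbackWave_single`, p161099, is already general in `a`; slice–leaf correspondence p127675);
* `stub_multiZoneFarEnergyBound` (FB₂) and `stub_multiZoneNearILED` (NZ₂) — the `N ≥ 2` children verbatim (the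
  Doppler budget of strict recession; the Milne / mid-frame-wall architectures of crux NOTES §2, §6).

Composition `AdiabaticMultiKerrILED_of` = the landed `adiabaticMultiKerrILED_of_subs` applied to
`T1 RFB`, `T2 RILED`, FB₂, NZ₂ — kernel-checked, concluding the crux BY NAME. `lean check`: sorries exactly in the
six `stub_*`.
-/

noncomputable section

-- the doubled `FinalStateConjecture.FinalStateConjecture` path component trips dupNamespace
set_option linter.dupNamespace false

open scoped ContDiff Topology BigOperators ENNReal InnerProductSpace
open Filter Set MeasureTheory Literature.Geometry.Lorentzian

namespace Summit.FinalStateConjecture.FinalStateConjecture.Cruxes.AdiabaticMultiKerrILED.RestFrameSeams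

/-! ### The single-zone seam in the REST FRAME (research stubs) -/

/-- **RFB — rest-frame far-energy bound for one tails-cut slowly rotating zone, tilted leaves.** There is `α > 0`
such that for `M > 0`, `|a| ≤ αM`, `η > 0` there is `C` with: for every `C²` height `F` of slope `≤ 1/2` and every
`C²` solution `Φ` of the tails-cut Kerr–Schild wave equation `□_{G_{M,a}} Φ = 0` on `{F(x⃗) ≤ x⁰} ∩ {r > r₊}`
(`G_{M,a} = η − σ(2 − r/8M)·2H_{M,a} ℓ♯⊗ℓ♯`, ingoing Kerr–Schild, exact Kerr on `r ≤ 8M`, flat beyond `16M`), the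
coordinate energy through the leaf `{x⁰ = s + F}` restricted to `{r ≥ r₊ + ηM}` is `≤ C ×` the energy through the
initial leaf outside the horizon, for all `s ≥ 0`. Zero-spin instance: LANDED (`restFrame_farEnergyBound`, p162234;
rung below). Open content: `0 < |a| ≤ αM` — Dafermos–Rodnianski-2011-type small-`a` superradiant boundedness for
the Gürses–Gürsey-type zone (mass function `Mσ(2 − r/8M)`; Carter-separable; for `α ≤ 1/8` every superradiant
frequency `ω < mΩ_H` is classically forbidden on the surgery annulus `8M ≤ r ≤ 16M`). [conjectural step of the line;
arXiv:0805.4309, arXiv:0810.5766, arXiv:1402.7034] -/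
theorem stub_restFrameFarEnergyBound_smallSpin :
    ∃ α : ℝ, 0 < α ∧ ∀ (M a η : ℝ), 0 < M → |a| ≤ α * M → 0 < η → ∃ C : NNReal, ∀ (F : E3 → ℝ) (Φ : E4 → ℝ), ContDiff ℝ 2 F → (∀ y, ‖fderiv ℝ F y‖ ≤ 2⁻¹) → ContDiff ℝ 2 Φ → (∀ x : E4, F (E4.spatial x) ≤ x 0 → Kerr.rPlus M a < Kerr.radius a x → KerrSchild.waveOperator (KerrSchild.inverseMetric (fun y ↦ Real.smoothTransition (2 - Kerr.radius a y / (8 * M)) * (2 * Kerr.scalarH M a y)) (Kerr.nullVector a)) Φ x = 0) → ∀ s : ℝ, 0 ≤ s → ∫⁻ y in {y : E3 | Kerr.rPlus M a + η * M ≤ Kerr.radius a (E4.ofTimeSpace (s + F y) y)}, ENNReal.ofReal (∑ μ : Fin 4, (fderiv ℝ Φ (E4.ofTimeSpace (s + F y) y) (E4.basisVector μ)) ^ 2) ≤ (C : ENNReal) * ∫⁻ y in {y : E3 | Kerr.rPlus M a < Kerr.radius a (E4.ofTimeSpace (0 + F y) y)}, ENNReal.ofReal (∑ μ : Fin 4,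 (fderiv ℝ Φ (E4.ofTimeSpace (0 + F y) y) (E4.basisVector μ)) ^ 2) := by
  sorry

/-- **RILED — rest-frame integrated local energy decay with loss of one derivative, tilted leaves.** There is
`α > 0` such that for `M > 0`, `|a| ≤ αM` there is `C` with: for every `C²` height `F` of slope `≤ 1/2`, every
smooth solution `Φ` of `□_{G_{M,a}} Φ = 0` on `{F ≤ x⁰} ∩ {r > r₊}`, every constant loss vector `k` with `k⁰ ≥ 1`,
`‖k⃗‖ ≤ k⁰/2` (the lab observer seen from the zone: `k = Λ⁻¹e₀`), and every constant `c` with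
`(Φ|_{leaf 0} − c)/‖y‖ ∈ L²` far out (the constant at infinity):
`∫₀^∞ ds ∫_{leaf s ∩ {r₊ < r < 64M}} [Σ_μ(∂_μΦ)² + (Φ − c)²/M²] ≤ C·(E_{leaf 0}[Φ] + E_{leaf 0}[k·∂Φ])`.
Content (zero spin): Morawetz `X = (1 − 3M/r)∂_{r*}` estimate for `g_χ(0)` degenerating at its unique photon sphere
`r = 3M` (p155345) with `χ″`-free Lagrangian weight and a Hardy current on `[2M, 7M]` (crux NOTES §7c), red-shift at
`r₊` (landed W1), one commutation for the non-degenerate form, zeroth order by the perforated Hardy / constant at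
infinity; small spin: `O(a)` perturbation / frequency-localised currents (research). [conjectural step of the line;
arXiv:0811.0354, arXiv:0802.3942, arXiv:0810.5766, arXiv:1402.7034] -/
theorem stub_restFrameZoneILED_smallSpin :
    ∃ α : ℝ, 0 < α ∧ ∀ (M a : ℝ), 0 < M → |a| ≤ α * M → ∃ C : NNReal, ∀ (F : E3 → ℝ) (Φ : E4 → ℝ) (k : E4), ContDiff ℝ 2 F → (∀ y, ‖fderiv ℝ F y‖ ≤ 2⁻¹) → ContDiff ℝ ∞ Φ → 1 ≤ k 0 → ‖E4.spatial k‖ ≤ 2⁻¹ * k 0 → (∀ x : E4, F (E4.spatial x) ≤ x 0 → Kerr.rPlus M a < Kerr.radius a x → KerrSchild.waveOperator (KerrSchild.inverseMetric (fun y ↦ Real.smoothTransition (2 - Kerr.radius a y / (8 * M)) * (2 * Kerr.scalarH M a y)) (Kerr.nullVector a)) Φ x = 0) → ∀ c : ℝ, (∃ ρ : ℝ, ∫⁻ y in {y : E3 | ρ < ‖y‖}, ENNReal.ofReal ((Φ (E4.ofTimeSpace (0 + F y) y) - c) ^ 2 / ‖y‖ ^ 2) < ⊤) → ∫⁻ s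 in Set.Ioi (0 : ℝ), ∫⁻ y in {y : E3 | Kerr.rPlus M a < Kerr.radius a (E4.ofTimeSpace (s + F y) y) ∧ Kerr.radius a (E4.ofTimeSpace (s + F y) y) < 64 * M}, ENNReal.ofReal ((∑ μ : Fin 4, (fderiv ℝ Φ (E4.ofTimeSpace (s + F y) y) (E4.basisVector μ)) ^ 2) + (Φ (E4.ofTimeSpace (s + F y) y) - c) ^ 2 / M ^ 2) ≤ (C : ENNReal) * ((∫⁻ y in {y : E3 | Kerr.rPlus M a < Kerr.radius a (E4.ofTimeSpace (0 + F y) y)}, ENNReal.ofReal (∑ μ : Fin 4, (fderiv ℝ Φ (E4.ofTimeSpace (0 + F y) y) (E4.basisVector μ)) ^ 2)) + ∫⁻ y in {y : E3 | Kerr.rPlus M a < Kerr.radius a (E4.ofTimeSpace (0 + F y) y)}, ENNReal.ofReal (∑ μ : Fin 4, (fderiv ℝ (fun x ↦ fderiv ℝ Φ x k) (E4.ofTimeSpace (0 + F y) y) (E4.basisVector μ)) ^ 2)) := by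
  sorry

/-! ### Transport to the lab children (classical stubs) -/

/-- **T1 — lab transport of RFB**: the rest-frame far-energy bound implies the route child
`SingleZoneFarEnergyBound` (`N = 1`, lab foliation, boost of speed `≤ v₀ = 1/2`): Poincaré pull-back
(`tailsCut_pullbackWave_single`, general in `a`), the lab slice `{x⁰ = t}` is the rest leaf `{z⁰ = t/u⁰ + F(z⃗)}` of the
linear height of `stub_sliceLeafCorrespondence`, change of variables and gradient comparability — verbatim the landed
zero-spin transport `singleZoneFarEnergyBound_zeroSpin_of_rest` (p161639) with `2M` replaced by `r₊(M,a)`; thresholds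
`α := min(α_RFB, 1/2)`, `v₀ := 1/2`, `d₀ := 1`, `t₁ := 0`. [folklore; O'Neill 1983 Ch. 9] -/
theorem stub_farEnergyBound_single_of_rest :
    (∃ α : ℝ, 0 < α ∧ ∀ (M a η : ℝ), 0 < M → |a| ≤ α * M → 0 < η → ∃ C : NNReal, ∀ (F : E3 → ℝ) (Φ : E4 → ℝ), ContDiff ℝ 2 F → (∀ y, ‖fderiv ℝ F y‖ ≤ 2⁻¹) → ContDiff ℝ 2 Φ → (∀ x : E4, F (E4.spatial x) ≤ x 0 → Kerr.rPlus M a < Kerr.radius a x → KerrSchild.waveOperator (KerrSchild.inverseMetric (fun y ↦ Real.smoothTransition (2 - Kerr.radius a y / (8 * M)) * (2 * Kerr.scalarH M a y)) (Kerr.nullVector a)) Φ x = 0) → ∀ s : ℝ, 0 ≤ s → ∫⁻ y in {y : E3 | Kerr.rPlus M a + η * M ≤ Kerr.radius a (E4.ofTimeSpace (s + F y) y)}, ENNReal.ofReal (∑ μ : Fin 4, (fderiv ℝ Φ (E4.ofTimeSpace (s + F y) y) (E4.basisVector μ)) ^ 2) ≤ (C : ENNReal) * ∫⁻ y in {y :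 E3 | Kerr.rPlus M a < Kerr.radius a (E4.ofTimeSpace (0 + F y) y)}, ENNReal.ofReal (∑ μ : Fin 4, (fderiv ℝ Φ (E4.ofTimeSpace (0 + F y) y) (E4.basisVector μ)) ^ 2)) →
    ∃ d₀ α v₀ : ℝ, 0 < d₀ ∧ 0 < α ∧ 0 < v₀ ∧ ∀ (M a : Fin 1 → ℝ) (Λ : Fin 1 → lorentzGroup) (p : Fin 1 → E3) (u : Fin 1 → E4) (q : Fin 1 → E4 → E4), (∀ i, u i = (Λ i : E4 ≃L[ℝ] E4) (E4.basisVector 0)) → (∀ i x, q i x = poincareInv (Λ i) (E4.ofTimeSpace 0 (p i)) x) → (∀ i, 0 < M i) → (∀ i, |a i| ≤ α * M i) → (∀ i, 0 < u i 0 ∧ ‖E4.spatial (u i)‖ ≤ v₀ * u i 0) → (∀ i j, i ≠ j → d₀ * (M i + M j) ≤ dist (p i) (p j) ∧ 0 < ⟪p i - p j, (u i 0)⁻¹ • E4.spatial (u i) - (u j 0)⁻¹ • E4.spatial (u j)⟫_ℝ) → ∀ (G : E4 → Fin 4 → Fin 4 → ℝ), (∀ x μ ν, G x μ ν = Minkowski.bilin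 (E4.basisVector μ) (E4.basisVector ν) - ∑ i, Real.smoothTransition (2 - Kerr.radius (a i) (q i x) / (8 * M i)) * (2 * Kerr.scalarH (M i) (a i) (q i x)) * ((Λ i : E4 ≃L[ℝ] E4) (Kerr.nullVector (a i) (q i x))) μ * ((Λ i : E4 ≃L[ℝ] E4) (Kerr.nullVector (a i) (q i x))) ν) → ∀ (E : (E4 → ℝ) → ℝ → ENNReal), (∀ φ t, E φ t = ∫⁻ y in {y : E3 | ∀ i, Kerr.rPlus (M i) (a i) < Kerr.radius (a i) (q i (E4.ofTimeSpace t y))}, ENNReal.ofReal (∑ μ : Fin 4, (fderiv ℝ φ (E4.ofTimeSpace t y) (E4.basisVector μ)) ^ 2)) → ∀ η : ℝ, 0 < η → ∃ (t₁ : ℝ) (C : NNReal), ∀ ψ : E4 → ℝ, ContDiff ℝ ∞ ψ → (∀ x : E4, 0 ≤ x 0 → (∀ i, Kerr.rPlus (M i) (a i) < Kerr.radius (a i) (q i x)) → ∑ μ : Fin 4, fderiv ℝ (fun y ↦ ∑ ν : Fin 4, G y μ ν * fderiv ℝ ψ y (E4.basisVector ν)) x (E4.basisVector μ) = 0) → ∀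 t : ℝ, t₁ ≤ t → ∫⁻ y in {y : E3 | ∀ i, Kerr.rPlus (M i) (a i) + η * M i ≤ Kerr.radius (a i) (q i (E4.ofTimeSpace t y))}, ENNReal.ofReal (∑ μ : Fin 4, (fderiv ℝ ψ (E4.ofTimeSpace t y) (E4.basisVector μ)) ^ 2) ≤ (C : ENNReal) * E ψ 0 := by
  sorry

/-- **T2 — lab transport of RILED**: the rest-frame ILED with loss implies the route child `SingleZoneNearILED`
(`N = 1`): as T1, plus (i) the lab spacetime integral `∫_{t>0} ∫_{r<64M, r>r₊}` is the image of `∫_{s>0} ∫_{leaf s ∩ …}`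
under the measure-preserving affine map (`t = u⁰ s`, Jacobian `J`), (ii) the lab loss term `E[∂₀ψ](0)` is the leaf-0
gradient energy of `k·∂Φ` with `k = Λ⁻¹e₀` (`k⁰ = u⁰ ≥ 1`, `‖k⃗‖ ≤ k⁰/2` for `v₀ = 1/2`) up to `κ²`, (iii) the
constant-at-infinity hypothesis transports under the affine slice map (`‖y‖ ≍ ‖y′‖` outside a ball). [folklore] -/
theorem stub_nearZoneILED_single_of_rest :
    (∃ α : ℝ, 0 < α ∧ ∀ (M a : ℝ), 0 < M → |a| ≤ α * M → ∃ C : NNReal, ∀ (F : E3 → ℝ) (Φ : E4 → ℝ) (k : E4), ContDiff ℝ 2 F → (∀ y, ‖fderiv ℝ F y‖ ≤ 2⁻¹) → ContDiff ℝ ∞ Φ → 1 ≤ k 0 → ‖E4.spatial k‖ ≤ 2⁻¹ * k 0 → (∀ x : E4, F (E4.spatial x) ≤ x 0 → Kerr.rPlus M a < Kerr.radius a x → KerrSchild.waveOperator (KerrSchild.inverseMetric (fun y ↦ Real.smoothTransition (2 - Kerr.radius a y / (8 * M)) * (2 * Kerr.scalarH M a y)) (Kerr.nullVector a)) Φ x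 = 0) → ∀ c : ℝ, (∃ ρ : ℝ, ∫⁻ y in {y : E3 | ρ < ‖y‖}, ENNReal.ofReal ((Φ (E4.ofTimeSpace (0 + F y) y) - c) ^ 2 / ‖y‖ ^ 2) < ⊤) → ∫⁻ s in Set.Ioi (0 : ℝ), ∫⁻ y in {y : E3 | Kerr.rPlus M a < Kerr.radius a (E4.ofTimeSpace (s + F y) y) ∧ Kerr.radius a (E4.ofTimeSpace (s + F y) y) < 64 * M}, ENNReal.ofReal ((∑ μ : Fin 4, (fderiv ℝ Φ (E4.ofTimeSpace (s + F y) y) (E4.basisVector μ)) ^ 2) + (Φ (E4.ofTimeSpace (s + F y) y) - c) ^ 2 / M ^ 2) ≤ (C : ENNReal) * ((∫⁻ y in {y : E3 | Kerr.rPlus M a < Kerr.radius a (E4.ofTimeSpace (0 + F y) y)}, ENNReal.ofReal (∑ μ : Fin 4, (fderiv ℝ Φ (E4.ofTimeSpace (0 + F y) y) (E4.basisVector μ)) ^ 2)) + ∫⁻ y in {y : E3 | Kerr.rPlus M a < Kerr.radius a (E4.ofTimeSpace (0 + F y) y)}, ENNReal.ofReal (∑ μ : Fin 4, (fderiv ℝ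 (fun x ↦ fderiv ℝ Φ x k) (E4.ofTimeSpace (0 + F y) y) (E4.basisVector μ)) ^ 2))) →
    ∃ d₀ α v₀ : ℝ, 0 < d₀ ∧ 0 < α ∧ 0 < v₀ ∧ ∀ (M a : Fin 1 → ℝ) (Λ : Fin 1 → lorentzGroup) (p : Fin 1 → E3) (u : Fin 1 → E4) (q : Fin 1 → E4 → E4), (∀ i, u i = (Λ i : E4 ≃L[ℝ] E4) (E4.basisVector 0)) → (∀ i x, q i x = poincareInv (Λ i) (E4.ofTimeSpace 0 (p i)) x) → (∀ i, 0 < M i) → (∀ i, |a i| ≤ α * M i) → (∀ i, 0 < u i 0 ∧ ‖E4.spatial (u i)‖ ≤ v₀ * u i 0) → (∀ i j, i ≠ j → d₀ * (M i + M j) ≤ dist (p i) (p j) ∧ 0 < ⟪p i - p j, (u i 0)⁻¹ • E4.spatial (u i) - (u j 0)⁻¹ • E4.spatial (u j)⟫_ℝ) → ∀ (G : E4 → Fin 4 → Fin 4 → ℝ), (∀ x μ ν, G x μ ν = Minkowski.bilin (E4.basisVector μ) (E4.basisVector ν) - ∑ i, Real.smoothTransition (2 - Kerr.radius (a i) (q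 i x) / (8 * M i)) * (2 * Kerr.scalarH (M i) (a i) (q i x)) * ((Λ i : E4 ≃L[ℝ] E4) (Kerr.nullVector (a i) (q i x))) μ * ((Λ i : E4 ≃L[ℝ] E4) (Kerr.nullVector (a i) (q i x))) ν) → ∀ (E : (E4 → ℝ) → ℝ → ENNReal), (∀ φ t, E φ t = ∫⁻ y in {y : E3 | ∀ i, Kerr.rPlus (M i) (a i) < Kerr.radius (a i) (q i (E4.ofTimeSpace t y))}, ENNReal.ofReal (∑ μ : Fin 4, (fderiv ℝ φ (E4.ofTimeSpace t y) (E4.basisVector μ)) ^ 2)) → ∃ C : NNReal, ∀ ψ : E4 → ℝ, ContDiff ℝ ∞ ψ → (∀ x : E4, 0 ≤ x 0 → (∀ i, Kerr.rPlus (M i) (a i) < Kerr.radius (a i) (q i x)) → ∑ μ : Fin 4, fderiv ℝ (fun y ↦ ∑ ν : Fin 4, G y μ ν * fderiv ℝ ψ y (E4.basisVector ν)) x (E4.basisVector μ) = 0) → ∀ c : ℝ, (∃ ρ : ℝ, ∫⁻ y in {y : E3 | ρ < ‖y‖}, ENNReal.ofReal ((ψ (E4.ofTimeSpace 0 y) -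 c) ^ 2 / ‖y‖ ^ 2) < ⊤) → ∀ i, ∫⁻ t in Set.Ioi (0 : ℝ), ∫⁻ y in {y : E3 | Kerr.radius (a i) (q i (E4.ofTimeSpace t y)) < 64 * M i ∧ ∀ j, Kerr.rPlus (M j) (a j) < Kerr.radius (a j) (q j (E4.ofTimeSpace t y))}, (ENNReal.ofReal (∑ μ : Fin 4, (fderiv ℝ ψ (E4.ofTimeSpace t y) (E4.basisVector μ)) ^ 2) + ENNReal.ofReal ((ψ (E4.ofTimeSpace t y) - c) ^ 2 / (M i) ^ 2)) ≤ (C : ENNReal) * (E ψ 0 + E (fun x ↦ fderiv ℝ ψ x (E4.basisVector 0)) 0) := by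
  sorry

/-! ### The multi-zone seam (research stubs = route children 3, 4 verbatim) -/

/-- **FB₂ — far-energy bound for `N ≥ 2` strictly receding zones** (route child `MultiZoneFarEnergyBound`; the heart:
the wave-level Doppler budget; `C ↑ ∞` as `Δv_min → 0`). Architectures: mid-frame Voronoi walls with the exactly
signed first-order wall bulk (p124932/p125283) + low-frequency wall estimate + far null form; or ONE Milne /
hyperboloidal current about a common past event (Milne bricks p146139…p151182) with McKean absorption and geometric
slabs, consuming RFB/RILED (through T1/T2 or directly in the rest frames) hole by hole and slab by slab.
[conjectural step of the line; Graf1990, arXiv:0811.0354, arXiv:1610.05226] -/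
theorem stub_multiZoneFarEnergyBound :
    ∀ N : ℕ, 2 ≤ N → ∃ d₀ α v₀ : ℝ, 0 < d₀ ∧ 0 < α ∧ 0 < v₀ ∧ ∀ (M a : Fin N → ℝ) (Λ : Fin N → lorentzGroup) (p : Fin N → E3) (u : Fin N → E4) (q : Fin N → E4 → E4), (∀ i, u i = (Λ i : E4 ≃L[ℝ] E4) (E4.basisVector 0)) → (∀ i x, q i x = poincareInv (Λ i) (E4.ofTimeSpace 0 (p i)) x) → (∀ i, 0 < M i) → (∀ i, |a i| ≤ α * M i) → (∀ i, 0 < u i 0 ∧ ‖E4.spatial (u i)‖ ≤ v₀ * u i 0) → (∀ i j, i ≠ j → d₀ * (M i + M j) ≤ dist (p i) (p j) ∧ 0 < ⟪p i - p j, (u i 0)⁻¹ • E4.spatial (u i) - (u j 0)⁻¹ • E4.spatial (u j)⟫_ℝ) → ∀ (G : E4 → Fin 4 → Fin 4 → ℝ), (∀ x μ ν, G x μ ν = Minkowski.bilin (E4.basisVector μ) (E4.basisVector ν) - ∑ i, Real.smoothTransition (2 - Kerr.radius (a i) (q i x) / (8 * M i)) * (2 * Kerr.scalarH (M i) (a i)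 (q i x)) * ((Λ i : E4 ≃L[ℝ] E4) (Kerr.nullVector (a i) (q i x))) μ * ((Λ i : E4 ≃L[ℝ] E4) (Kerr.nullVector (a i) (q i x))) ν) → ∀ (E : (E4 → ℝ) → ℝ → ENNReal), (∀ φ t, E φ t = ∫⁻ y in {y : E3 | ∀ i, Kerr.rPlus (M i) (a i) < Kerr.radius (a i) (q i (E4.ofTimeSpace t y))}, ENNReal.ofReal (∑ μ : Fin 4, (fderiv ℝ φ (E4.ofTimeSpace t y) (E4.basisVector μ)) ^ 2)) → ∀ η : ℝ, 0 < η → ∃ (t₁ : ℝ) (C : NNReal), ∀ ψ : E4 → ℝ, ContDiff ℝ ∞ ψ → (∀ x : E4, 0 ≤ x 0 → (∀ i, Kerr.rPlus (M i) (a i) < Kerr.radius (a i) (q i x)) → ∑ μ : Fin 4, fderiv ℝ (fun y ↦ ∑ ν : Fin 4, G y μ ν * fderiv ℝ ψ y (E4.basisVector ν)) x (E4.basisVector μ) = 0) → ∀ t : ℝ, t₁ ≤ t → ∫⁻ y in {y : E3 | ∀ i, Kerr.rPlus (M i) (a i) + η * M i ≤ Kerr.radius (a i) (q i (E4.ofTimeSpace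 t y))}, ENNReal.ofReal (∑ μ : Fin 4, (fderiv ℝ ψ (E4.ofTimeSpace t y) (E4.basisVector μ)) ^ 2) ≤ (C : ENNReal) * E ψ 0 := by
  sorry

/-- **NZ₂ — zone ILED with loss and renewal for `N ≥ 2` strictly receding zones** (route child `MultiZoneNearILED`):
single-zone degenerate Morawetz fields glued at the Voronoi scale into one multiplier on `[t₁, ∞)`, one commutation,
renewal of re-entering energy by the ray-level Doppler law (p146000/p148395; support item RecedingDopplerBudget).
[conjectural step of the line; arXiv:0811.0354, Graf1990] -/
theorem stub_multiZoneNearILED :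
    ∀ N : ℕ, 2 ≤ N → ∃ d₀ α v₀ : ℝ, 0 < d₀ ∧ 0 < α ∧ 0 < v₀ ∧ ∀ (M a : Fin N → ℝ) (Λ : Fin N → lorentzGroup) (p : Fin N → E3) (u : Fin N → E4) (q : Fin N → E4 → E4), (∀ i, u i = (Λ i : E4 ≃L[ℝ] E4) (E4.basisVector 0)) → (∀ i x, q i x = poincareInv (Λ i) (E4.ofTimeSpace 0 (p i)) x) → (∀ i, 0 < M i) → (∀ i, |a i| ≤ α * M i) → (∀ i, 0 < u i 0 ∧ ‖E4.spatial (u i)‖ ≤ v₀ * u i 0) → (∀ i j, i ≠ j → d₀ * (M i + M j) ≤ dist (p i) (p j) ∧ 0 < ⟪p i - p j, (u i 0)⁻¹ • E4.spatial (u i) - (u j 0)⁻¹ • E4.spatial (u j)⟫_ℝ) → ∀ (G : E4 → Fin 4 → Fin 4 → ℝ), (∀ x μ ν, G x μ ν = Minkowski.bilin (E4.basisVector μ) (E4.basisVector ν) - ∑ i, Real.smoothTransition (2 - Kerr.radius (a i) (q i x) / (8 * M i)) * (2 * Kerr.scalarH (M i) (a i) (q i x)) * ((Λ i : E4 ≃L[ℝ]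 E4) (Kerr.nullVector (a i) (q i x))) μ * ((Λ i : E4 ≃L[ℝ] E4) (Kerr.nullVector (a i) (q i x))) ν) → ∀ (E : (E4 → ℝ) → ℝ → ENNReal), (∀ φ t, E φ t = ∫⁻ y in {y : E3 | ∀ i, Kerr.rPlus (M i) (a i) < Kerr.radius (a i) (q i (E4.ofTimeSpace t y))}, ENNReal.ofReal (∑ μ : Fin 4, (fderiv ℝ φ (E4.ofTimeSpace t y) (E4.basisVector μ)) ^ 2)) → ∃ C : NNReal, ∀ ψ : E4 → ℝ, ContDiff ℝ ∞ ψ → (∀ x : E4, 0 ≤ x 0 → (∀ i, Kerr.rPlus (M i) (a i) < Kerr.radius (a i) (q i x)) → ∑ μ : Fin 4, fderiv ℝ (fun y ↦ ∑ ν : Fin 4, G y μ ν * fderiv ℝ ψ y (E4.basisVector ν)) x (E4.basisVector μ) = 0) → ∀ c : ℝ, (∃ ρ : ℝ, ∫⁻ y in {y : E3 | ρ < ‖y‖}, ENNReal.ofReal ((ψ (E4.ofTimeSpace 0 y) - c) ^ 2 / ‖y‖ ^ 2) < ⊤) → ∀ i, ∫⁻ t in Set.Ioi (0 : ℝ), ∫⁻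 y in {y : E3 | Kerr.radius (a i) (q i (E4.ofTimeSpace t y)) < 64 * M i ∧ ∀ j, Kerr.rPlus (M j) (a j) < Kerr.radius (a j) (q j (E4.ofTimeSpace t y))}, (ENNReal.ofReal (∑ μ : Fin 4, (fderiv ℝ ψ (E4.ofTimeSpace t y) (E4.basisVector μ)) ^ 2) + ENNReal.ofReal ((ψ (E4.ofTimeSpace t y) - c) ^ 2 / (M i) ^ 2)) ≤ (C : ENNReal) * (E ψ 0 + E (fun x ↦ fderiv ℝ ψ x (E4.basisVector 0)) 0) := by
  sorry

/-! ### Rung and composition (sorry-free) -/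

/-- **Rung (BC5-style witness for RFB): the zero-spin instance of `stub_restFrameFarEnergyBound_smallSpin` is in the
tree** — it is `restFrame_farEnergyBound` (lead c7, p162234) with `2M = r₊(M, 0)`. [folklore] -/
theorem restFrameFarEnergyBound_zeroSpin_rung :
    ∀ (M η : ℝ), 0 < M → 0 < η → ∃ C : NNReal, ∀ (F : E3 → ℝ) (Φ : E4 → ℝ), ContDiff ℝ 2 F → (∀ y, ‖fderiv ℝ F y‖ ≤ 2⁻¹) → ContDiff ℝ 2 Φ → (∀ x : E4, F (E4.spatial x) ≤ x 0 → Kerr.rPlus M 0 < Kerr.radius 0 x → KerrSchild.waveOperator (KerrSchild.inverseMetric (fun y ↦ Real.smoothTransition (2 - Kerr.radius 0 y / (8 * M)) * (2 * Kerr.scalarH M 0 y)) (Kerr.nullVector 0)) Φ x = 0) → ∀ s : ℝ, 0 ≤ s → ∫⁻ y in {y : E3 | Kerr.rPlus M 0 + η * M ≤ Kerr.radius 0 (E4.ofTimeSpace (s + F y) y)}, ENNReal.ofReal (∑ μ : Fin 4, (fderiv ℝ Φ (E4.ofTimeSpace (s + F y) y) (E4.basisVector μ)) ^ 2) ≤ (C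 : ENNReal) * ∫⁻ y in {y : E3 | Kerr.rPlus M 0 < Kerr.radius 0 (E4.ofTimeSpace (0 + F y) y)}, ENNReal.ofReal (∑ μ : Fin 4, (fderiv ℝ Φ (E4.ofTimeSpace (0 + F y) y) (E4.basisVector μ)) ^ 2) := by
  intro M η hM hη
  obtain ⟨C, hC⟩ := Summit.FinalStateConjecture.FinalStateConjecture.Theorems.restFrame_farEnergyBound M η hM hη
  refine ⟨C, fun F Φ hF hslope hΦ hsol s hs ↦ ?_⟩
  have h2 : Kerr.rPlus M 0 = 2 * M := Kerr.rPlus_zero_right hM.le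
  have h2η : (2 : ℝ) * M + η * M = (2 + η) * M := by ring
  simp only [h2, h2η]
  exact hC F Φ hF hslope hΦ (fun x hx hr ↦ hsol x hx (by rwa [h2])) s hs

/-- **Composition (skeleton theorem of line `rest-frame-seams`).** The crux `AdiabaticMultiKerrILED`, BY NAME and
without hypotheses, from the six stubs through the landed route-level split glue `adiabaticMultiKerrILED_of_subs`. -/
theorem AdiabaticMultiKerrILED_of :
    Summit.FinalStateConjecture.FinalStateConjecture.Theses.ClusterCompleteness.AdiabaticMultiKerrILED :=
  Summit.FinalStateConjecture.FinalStateConjecture.Theorems.ClusterCompleteness.AdiabaticMultiKerrILEDSplit.adiabaticMultiKerrILED_of_subs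
    (stub_farEnergyBound_single_of_rest stub_restFrameFarEnergyBound_smallSpin)
    (stub_nearZoneILED_single_of_rest stub_restFrameZoneILED_smallSpin)
    stub_multiZoneFarEnergyBound stub_multiZoneNearILED

end Summit.FinalStateConjecture.FinalStateConjecture.Cruxes.AdiabaticMultiKerrILED.RestFrameSeams

end
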